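import Literature.Analysis.Asymptotics.LaplaceMethodChart
import Literature.MathematicalPhysics.QuantumFieldTheory.Balaban1983to89.HaarExponentialChartGlobal
import HarnessLib

/-!
# The Laplace method ON A COMPACT GROUP (Haar measure): Gibbs measures `e^{−βf} dμ ∕ Z_β` on a compact matrix group
# concentrate at a unique non-degenerate minimum, with the Gaussian constant read in exponential coordinates

Topic `Literature/Analysis/Asymptotics`; sequel of `LaplaceMethodChart.lean` (`tendsto_laplaceMethod_chart`: Laplace's
method through a measurable chart with density).  Everything here is PROVED; no definitions, no named facts.

SETTING.  The tree's «compact group faithfully represented on a log-charted linear group»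
(`Balaban1983to89.HaarExponentialChart.IsChartRep C ρ`: `G` compact, `ρ : G →* 𝔸` continuous injective onto the
carrier of a `LogChart C` of a Banach algebra `𝔸`, Lie algebra `𝔤 = C.lie` finite-dimensional and `ad`-stable —
every closed subgroup of `U(N)`, in particular `SU(N)` and `U(N)` of every rank, `isChartRep_specialUnitaryGroup` ∕
`isChartRep_unitaryGroup`), its exponential chart `Θ = h.expChart : 𝔤 → G`, a Haar measure `μ` on `G`, and a
EUCLIDEAN FRAME of the Lie algebra: a continuous linear isomorphism `e : V ≃L[ℝ] 𝔤` from a finite-dimensional real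
inner product space `V` (dimension `d = dim G`; e.g. an orthonormal basis of `𝔰𝔲(N)` for `−2 tr(XY)`), through which
Hessians and Lebesgue measure are read.

RESULTS (namespace `Literature.Analysis.Asymptotics`):
* §1 `haar_restrict_window_eq_map_withDensity_frame` — HAAR MEASURE IN EXPONENTIAL COORDINATES IN THE FRAME `e`, in
  the chart-identity format of `LaplaceMethodChart`: on the canonical window `V = Θ(B(0, s_C/2))`,
  `μ|_V = (Θ∘e)_*((J · dv)|_{e⁻¹B})` with `J(v) = σ₀(e) · |det((1 − e^{−adX})∕adX)|_{X = e v}`, where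
  `σ₀(e) = μ(V_{s_C}) ∕ ν_{s_C}(V_{s_C})` is the tree's window constant for the Lebesgue measure `e_* dv` on `𝔤`
  (Helgason Ch. I Thm 1.14 (13) — the tree's `IsChartRep.haar_restrict_image_eq_smul_chartMeasureOn`, reformatted);
  `haar_restrict_translate_window_eq_map_withDensity_frame` — the same around any `g₀ ∈ G` for the chart
  `v ↦ g₀ · Θ(e v)` (left invariance);
* §2 ★★ `tendsto_laplaceMethod_haar` — LAPLACE'S METHOD ON `G`: for `f : G → ℝ` continuous with a UNIQUE minimum
  point `g₀` which is NON-DEGENERATE in exponential coordinates,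
  `f(g₀ Θ(e v)) = f(g₀) + ½⟪Av, v⟫ + o(‖v‖²)` (`A` symmetric positive definite on `V`), and `φ : G → ℝ` continuous,
  `β^{d/2} ∫_G e^{−β(f − f(g₀))} φ dμ ⟶ (2π)^{d/2} (det A)^{−1/2} · σ₀(e) · φ(g₀)`;
  ★★ `tendsto_gibbs_expectation_haar` — THE CONSTANT-FREE FORM:
  `∫_G e^{−βf} φ dμ ∕ ∫_G e^{−βf} dμ ⟶ φ(g₀)` (`β → ∞`);
* §3 the instances `tendsto_gibbs_expectation_haar_specialUnitaryGroup` ∕ `_unitaryGroup` (every rank).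

On a compact group the two separation hypotheses of `tendsto_laplaceMethod_chart` are AUTOMATIC from continuity of
`f` and uniqueness of the minimiser (minimum of `f − f(g₀)` over the compact sets `g₀Θ(e(B̄ ∖ B_δ))` and
`G ∖ g₀V`, both missing `g₀` by injectivity of the chart), and integrability is automatic (continuous functions,
finite Haar measure); what the consumer supplies is only the second-order expansion of `f` at `g₀` in the chart.

HONEST FRAMING: classical analysis on compact Lie groups (Laplace ∕ stationary phase at a non-degenerate critical
point, the Haar density entering through its value `σ₀` at the identity); an input for «`β → ∞` at fixed box» ∕
semiclassical one-link and one-plaquette integrals (cell `ym-ir`, row 43); the Morse–Bott ∕ gauge-orbit version that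
the twisted-slab programme (brick M1) needs is `tendsto_laplaceMethod_fibred_chart` plus a slice theorem, NOT this
file; width 0 by itself toward any lattice statement; the Yang–Mills mass gap (Clay) is NOT touched; `R4` closes
only `BalabanLadder.UV`.

## References
* S. Helgason, *Groups and Geometric Analysis*, AMS Math. Surveys Monogr. 83 (2000), Ch. I §1 Thm 1.14 (13) p. 96
  (Haar measure in canonical coordinates: `∫_G f(g)dg = ∫_𝔤 f(exp X) det((1−e^{−adX})∕adX) dX`). [Helgason2000]
* K. W. Breitung, *Asymptotic Approximations for Probability Integrals*, LNM 1592 (1994), Thm 41 p. 56 (interior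
  non-degenerate extremum, leading order with the constant), §2.3 pp. 14–15 (local coordinates). [Breitung1994]
* C.-R. Hwang, *Laplace's method revisited: weak convergence of probability measures*, Ann. Probab. 8 (1980)
  1177–1182 (`e^{−nℓ}dμ₀∕Z_n ⇒` point mass at a unique minimum; general reference measure). [Hwang1980]
* T. Bałaban, Commun. Math. Phys. **102** (1985) 255–275, p. 260 («dU′ = σ(A′)dA′ = σ₀ (σ∕σ₀)(A′)dA′»). [Balaban1985UV3]
-/

noncomputable section

open _root_.MeasureTheory _root_.Filter _root_.Set _root_.Module _root_.Topology
open scoped _root_.Real _root_.InnerProductSpace _root_.ENNReal _root_.NNReal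
open Literature.MathematicalPhysics.QuantumFieldTheory.Balaban1983to89
open Literature.MathematicalPhysics.QuantumFieldTheory.Balaban1983to89.HaarExponentialChart
open Literature.MathematicalPhysics.QuantumFieldTheory.Balaban1983to89.B13HaarSigmaJacobian (jac)

namespace Literature.Analysis.Asymptotics

variable {𝔸 : Type*} [NormedRing 𝔸] [NormedAlgebra ℂ 𝔸] [CompleteSpace 𝔸]
variable {G : Type*} [Group G] [TopologicalSpace G] [IsTopologicalGroup G] [CompactSpace G]
  [MeasurableSpace G] [BorelSpace G]
variable {C : LogChart 𝔸} {ρ : G →* 𝔸} (h : IsChartRep C ρ) [FiniteDimensional ℝ C.lie]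
  (hlie : ∀ x ∈ C.lie, ∀ y ∈ C.lie, x * y - y * x ∈ C.lie)
variable [MeasurableSpace C.lie] [BorelSpace C.lie]
variable (μ : Measure G) [μ.IsHaarMeasure]
variable {V : Type*} [NormedAddCommGroup V] [InnerProductSpace ℝ V] [FiniteDimensional ℝ V]
  [MeasurableSpace V] [BorelSpace V] (e : V ≃L[ℝ] C.lie)

/-! ## §1 Haar measure in exponential coordinates, in a Euclidean frame of the Lie algebra (chart-identity format) -/

section Frame

omit [NormedAlgebra ℂ 𝔸] [CompleteSpace 𝔸] [IsTopologicalGroup G] [CompactSpace G] [BorelSpace G]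
  [FiniteDimensional ℝ C.lie] [BorelSpace C.lie] [InnerProductSpace ℝ V] [FiniteDimensional ℝ V] [BorelSpace V] in
/-- Push-forward and density commute along a measurable embedding: `(κ∘e⁻¹)·F = (κ·(F∘e))∘e⁻¹`. [folklore] -/
private theorem withDensity_map_eq_map_withDensity {α γ : Type*} [MeasurableSpace α] [MeasurableSpace γ]
    (κ : Measure α) {ι : α → γ} (hι : MeasurableEmbedding ι) {F : γ → ℝ≥0∞} (hF : Measurable F) :
    (κ.map ι).withDensity F = (κ.withDensity (F ∘ ι)).map ι := by
  ext B hB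
  rw [withDensity_apply _ hB, Measure.restrict_map hι.measurable hB, lintegral_map hF hι.measurable,
    Measure.map_apply hι.measurable hB, withDensity_apply _ (hι.measurable hB)]
  rfl

omit [CompleteSpace 𝔸] [FiniteDimensional ℝ C.lie] in
/-- The frame `e` pushes Lebesgue measure of `V` to an additive Haar measure of `𝔤`. [folklore] -/
private theorem isAddHaarMeasure_map_frame : ((volume : Measure V).map e).IsAddHaarMeasure :=
  e.isAddHaarMeasure_map volume

/-- **Haar measure in exponential coordinates, read in a Euclidean frame `e : V ≃ 𝔤` — chart-identity format.**
On the canonical window `Θ(B(0, s_C/2)) = (Θ∘e)(e⁻¹B(0, s_C/2))`: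
`μ|_{Θ(B)} = (Θ∘e)_*((J · dv)|_{e⁻¹B})`, `J(v) = σ₀(e) · |det jac(e v)|`, `jac X = (1 − e^{−adX})∕adX` on `𝔤`,
`σ₀(e) = μ(V_{s_C}) ∕ ν_{s_C}(V_{s_C})` the tree's window constant for `η = e_* dv` — Helgason's (13) with «`dX`»
the Lebesgue measure of the frame. [cite: Helgason2000, Ch. I §1 Thm 1.14 (13) p. 96]
[cite: Balaban1985UV3, p. 260 (dU′ = σ₀ (σ∕σ₀)(A′) dA′)] -/
theorem haar_restrict_window_eq_map_withDensity_frame :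
    μ.restrict ((fun v => h.expChart (e v)) '' (e ⁻¹' Metric.ball (0 : C.lie) (IsChartRep.chartRadius C / 2))) =
      (((volume : Measure V).restrict (e ⁻¹' Metric.ball (0 : C.lie) (IsChartRep.chartRadius C / 2))).withDensity
          fun v => ENNReal.ofReal
            ((μ (h.window (IsChartRep.chartRadius C)) /
                h.chartMeasure hlie ((volume : Measure V).map e) (IsChartRep.chartRadius C)
                  (h.window (IsChartRep.chartRadius C))).toReal *
              |LinearMap.det (jac hlie (e v) : C.lie →ₗ[ℝ] C.lie)|)).map
        (fun v => h.expChart (e v)) := by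
  haveI := isAddHaarMeasure_map_frame (V := V) e
  set s := IsChartRep.chartRadius C with hs_def
  set η : Measure C.lie := (volume : Measure V).map e with hη
  set c : ℝ≥0∞ := μ (h.window s) / h.chartMeasure hlie η s (h.window s) with hc
  have hs0 : 0 < s := IsChartRep.chartRadius_pos
  have hs2 : s / 2 ≤ s := by linarith
  have hc' := h.windowConst_ne_zero_and_ne_top hlie η μ hs0 le_rfl
  have he : MeasurableEmbedding (e : V → C.lie) := e.toHomeomorph.measurableEmbedding
  set B : Set C.lie := Metric.ball (0 : C.lie) (s / 2) with hB
  have hBm : MeasurableSet B := Metric.isOpen_ball.measurableSet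
  -- the image of the frame ball is the window
  have himg : (fun v => h.expChart (e v)) '' (e ⁻¹' B) = h.expChart '' B := by
    rw [show (fun v => h.expChart (e v)) = h.expChart ∘ e from rfl, Set.image_comp,
      Set.image_preimage_eq B e.surjective]
  -- the tree's identity `μ|_{Θ B} = c • Θ_*((jacDensity · η)|_B)`
  have htree := h.haar_restrict_image_eq_smul_chartMeasureOn hlie η μ hs0 le_rfl hBm
    ((h.injOn_expChart le_rfl).mono (Metric.ball_subset_ball hs2))
  rw [himg, htree, IsChartRep.chartMeasureOn]
  -- reformat: `η|_B = e_*(dv|_{e⁻¹B})`, density through the frame, constant into the density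
  have hrestr : η.restrict B = ((volume : Measure V).restrict (e ⁻¹' B)).map e := by
    rw [hη, Measure.restrict_map e.continuous.measurable hBm]
  have hdens : ∀ v : V, c * jacDensity hlie (e v) =
      ENNReal.ofReal (c.toReal * |LinearMap.det (jac hlie (e v) : C.lie →ₗ[ℝ] C.lie)|) := fun v => by
    rw [ENNReal.ofReal_mul ENNReal.toReal_nonneg, ENNReal.ofReal_toReal hc'.2, jacDensity_def]
  rw [hrestr, withDensity_map_eq_map_withDensity _ he (measurable_jacDensity hlie), Measure.map_map
    h.measurable_expChart e.continuous.measurable, ← Measure.map_smul,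
    ← withDensity_smul _ ((measurable_jacDensity hlie).comp e.continuous.measurable)]
  have hdens' : c • (jacDensity hlie ∘ (e : V → C.lie)) =
      fun v => ENNReal.ofReal (c.toReal * |LinearMap.det (jac hlie (e v) : C.lie →ₗ[ℝ] C.lie)|) := by
    funext v
    simp only [Pi.smul_apply, Function.comp_apply, smul_eq_mul, hdens v]
  rw [hdens']
  rfl

omit [CompactSpace G] in
/-- Left translates: for a left-invariant `μ`, `μ|_{g₀S} = (g₀ ·)_*(μ|_S)`. [folklore] -/
private theorem restrict_image_mul_left_eq_map (S : Set G) (g₀ : G) :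
    μ.restrict ((fun g => g₀ * g) '' S) = (μ.restrict S).map fun g => g₀ * g := by
  have hm : Measurable fun g : G => g₀ * g := measurable_const_mul g₀
  have himg : (fun g => g₀ * g) '' S = (fun g => g₀⁻¹ * g) ⁻¹' S := by
    ext g
    constructor
    · rintro ⟨k, hk, rfl⟩
      simpa [inv_mul_cancel_left] using hk
    · intro hg
      exact ⟨g₀⁻¹ * g, hg, by simp⟩
  ext B hB
  rw [Measure.restrict_apply hB, Measure.map_apply hm hB, Measure.restrict_apply (hm hB), himg]
  have hpre : (fun g => g₀ * g) ⁻¹' B ∩ S = (fun g => g₀ * g) ⁻¹' (B ∩ (fun g => g₀⁻¹ * g) ⁻¹' S) := by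
    ext g
    simp only [Set.mem_inter_iff, Set.mem_preimage, inv_mul_cancel_left]
  rw [hpre, measure_preimage_mul]

/-- **Haar measure in exponential coordinates AROUND ANY POINT `g₀`** (chart `v ↦ g₀ · Θ(e v)`, left invariance):
`μ|_{g₀Θ(B)} = (g₀Θ∘e)_*((J · dv)|_{e⁻¹B})` with the same density `J`.
[cite: Helgason2000, Ch. I §1 Thm 1.14 (13) p. 96] [cite: Balaban1985UV3, p. 260] -/
theorem haar_restrict_translate_window_eq_map_withDensity_frame (g₀ : G) :
    μ.restrict ((fun v => g₀ * h.expChart (e v)) '' (e ⁻¹' Metric.ball (0 : C.lie) (IsChartRep.chartRadius C / 2))) =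
      (((volume : Measure V).restrict (e ⁻¹' Metric.ball (0 : C.lie) (IsChartRep.chartRadius C / 2))).withDensity
          fun v => ENNReal.ofReal
            ((μ (h.window (IsChartRep.chartRadius C)) /
                h.chartMeasure hlie ((volume : Measure V).map e) (IsChartRep.chartRadius C)
                  (h.window (IsChartRep.chartRadius C))).toReal *
              |LinearMap.det (jac hlie (e v) : C.lie →ₗ[ℝ] C.lie)|)).map
        (fun v => g₀ * h.expChart (e v)) := by
  set Ω : Set V := e ⁻¹' Metric.ball (0 : C.lie) (IsChartRep.chartRadius C / 2) with hΩ
  have hcomp : (fun v => g₀ * h.expChart (e v)) = (fun g => g₀ * g) ∘ fun v => h.expChart (e v) := rfl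
  have hΘm : Measurable fun v => h.expChart (e v) := h.measurable_expChart.comp e.continuous.measurable
  rw [hcomp, Set.image_comp, restrict_image_mul_left_eq_map μ _ g₀,
    haar_restrict_window_eq_map_withDensity_frame h hlie μ e, Measure.map_map (measurable_const_mul g₀) hΘm]

end Frame

/-! ## §2 Laplace's method on the group: a unique minimum, non-degenerate in exponential coordinates -/

section Laplace

omit [MeasurableSpace G] [BorelSpace G] [MeasurableSpace C.lie] [BorelSpace C.lie] [FiniteDimensional ℝ V]
  [MeasurableSpace V] [BorelSpace V] in
/-- Separation INSIDE the chart on a compact group: if `g₀` is the unique minimiser of the continuous `f`, then for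
every `δ > 0` there is `η > 0` with `f(g₀Θ(e v)) ≥ f(g₀) + η` whenever `‖e v‖ < s_C/2` and `‖v‖ ≥ δ` (minimum over a
compact annulus missing `0`, injectivity of `Θ` on `B(0, s_C)`). [folklore] -/
private theorem sep_in_of_unique_min {f : G → ℝ} {g₀ : G} (hf : Continuous f) (hmin : ∀ g, g ≠ g₀ → f g₀ < f g) :
    ∀ δ : ℝ, 0 < δ → ∃ η : ℝ, 0 < η ∧
      ∀ v ∈ e ⁻¹' Metric.ball (0 : C.lie) (IsChartRep.chartRadius C / 2), δ ≤ ‖v - 0‖ →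
        f (g₀ * h.expChart (e 0)) + η ≤ f (g₀ * h.expChart (e v)) := by
  intro δ hδ
  set s := IsChartRep.chartRadius C with hs_def
  have hs0 : 0 < s := IsChartRep.chartRadius_pos
  have hΘc : Continuous fun v : V => g₀ * h.expChart (e v) :=
    continuous_const.mul (h.continuous_expChart.comp e.continuous)
  have h0 : g₀ * h.expChart (e 0) = g₀ := by
    rw [map_zero, IsChartRep.expChart_zero, mul_one]
  set K : Set V := e ⁻¹' Metric.closedBall (0 : C.lie) (s / 2) ∩ {v | δ ≤ ‖v‖} with hK
  have hKc : IsCompact K := by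
    have h1 : IsCompact (e ⁻¹' Metric.closedBall (0 : C.lie) (s / 2)) :=
      e.toHomeomorph.isCompact_preimage.2 (isCompact_closedBall _ _)
    exact h1.inter_right (isClosed_le continuous_const continuous_norm)
  by_cases hKne : K.Nonempty
  · obtain ⟨v₀, hv₀K, hv₀min⟩ := hKc.exists_isMinOn hKne (hf.comp hΘc).continuousOn
    have hv₀ne : v₀ ≠ 0 := by
      intro h0v
      have := hv₀K.2
      simp only [Set.mem_setOf_eq, h0v, norm_zero] at this
      linarith
    have hΘv₀ : g₀ * h.expChart (e v₀) ≠ g₀ := by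
      intro heq
      have h1 : h.expChart (e v₀) = h.expChart 0 := by
        rw [IsChartRep.expChart_zero]; simpa using heq
      have hball : (e v₀ : C.lie) ∈ Metric.ball (0 : C.lie) s := by
        have := hv₀K.1
        rw [Set.mem_preimage, Metric.mem_closedBall] at this
        rw [Metric.mem_ball]; linarith
      have h2 := h.injOn_expChart le_rfl hball (Metric.mem_ball_self hs0) h1
      exact hv₀ne (by simpa using h2)
    refine ⟨f (g₀ * h.expChart (e v₀)) - f g₀, sub_pos.2 (hmin _ hΘv₀), fun v hv hδv => ?_⟩
    rw [h0]
    have hvK : v ∈ K := by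
      refine ⟨?_, ?_⟩
      · rw [Set.mem_preimage] at hv ⊢
        exact Metric.ball_subset_closedBall hv
      · simpa [sub_zero] using hδv
    have hle : (f ∘ fun v => g₀ * h.expChart (e v)) v₀ ≤ (f ∘ fun v => g₀ * h.expChart (e v)) v := hv₀min hvK
    simp only [Function.comp_apply] at hle
    linarith
  · refine ⟨1, one_pos, fun v hv hδv => (hKne ⟨v, ?_, ?_⟩).elim⟩
    · rw [Set.mem_preimage] at hv ⊢
      exact Metric.ball_subset_closedBall hv
    · simpa [sub_zero] using hδv

omit [MeasurableSpace G] [BorelSpace G] [FiniteDimensional ℝ C.lie] [MeasurableSpace C.lie] [BorelSpace C.lie]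
  [FiniteDimensional ℝ V] [MeasurableSpace V] [BorelSpace V] in
/-- Separation OFF the chart on a compact group: the complement of the open patch `g₀Θ(B(0, s_C/2))` is compact and
misses the unique minimiser `g₀`, so `f ≥ f(g₀) + η₀` there for some `η₀ > 0`. [folklore] -/
private theorem sep_out_of_unique_min {f : G → ℝ} {g₀ : G} (hf : Continuous f) (hmin : ∀ g, g ≠ g₀ → f g₀ < f g) :
    ∃ η₀ : ℝ, 0 < η₀ ∧ ∀ x, x ∉ (fun v => g₀ * h.expChart (e v)) '' (e ⁻¹' Metric.ball (0 : C.lie)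
        (IsChartRep.chartRadius C / 2)) →
      f (g₀ * h.expChart (e 0)) + η₀ ≤ f x := by
  set s := IsChartRep.chartRadius C with hs_def
  have hs0 : 0 < s := IsChartRep.chartRadius_pos
  have hs2 : s / 2 ≤ s := by linarith
  have h0 : g₀ * h.expChart (e 0) = g₀ := by
    rw [map_zero, IsChartRep.expChart_zero, mul_one]
  have himg : (fun v => g₀ * h.expChart (e v)) '' (e ⁻¹' Metric.ball (0 : C.lie) (s / 2)) =
      (fun g => g₀ * g) '' h.window (s / 2) := by
    rw [show (fun v => g₀ * h.expChart (e v)) = (fun g => g₀ * g) ∘ h.expChart ∘ e from rfl, Set.image_comp,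
      Set.image_comp, Set.image_preimage_eq _ e.surjective]
    rfl
  have hopen : IsOpen ((fun v => g₀ * h.expChart (e v)) '' (e ⁻¹' Metric.ball (0 : C.lie) (s / 2))) := by
    rw [himg]; exact isOpenMap_mul_left g₀ _ (h.isOpen_window hs2)
  have hKc : IsCompact ((fun v => g₀ * h.expChart (e v)) '' (e ⁻¹' Metric.ball (0 : C.lie) (s / 2)))ᶜ :=
    hopen.isClosed_compl.isCompact
  by_cases hne : (((fun v => g₀ * h.expChart (e v)) '' (e ⁻¹' Metric.ball (0 : C.lie) (s / 2)))ᶜ).Nonempty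
  · obtain ⟨x₀, hx₀, hx₀min⟩ := hKc.exists_isMinOn hne hf.continuousOn
    have hx₀ne : x₀ ≠ g₀ := by
      intro heq
      apply hx₀
      refine ⟨0, ?_, by beta_reduce; rw [h0, heq]⟩
      rw [Set.mem_preimage, map_zero]
      exact Metric.mem_ball_self (by linarith)
    refine ⟨f x₀ - f g₀, sub_pos.2 (hmin x₀ hx₀ne), fun x hx => ?_⟩
    rw [h0]
    have hle : f x₀ ≤ f x := hx₀min hx
    linarith
  · exact ⟨1, one_pos, fun x hx => (hne ⟨x, hx⟩).elim⟩

/-- **Laplace's method on a compact group (Haar measure), unique non-degenerate minimum.**  Let `G` be a compact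
group faithfully represented on a log-charted linear group (`h : IsChartRep C ρ`; every closed subgroup of `U(N)`,
e.g. `SU(N)`, `U(N)`), `Θ = h.expChart : 𝔤 → G` its exponential chart, `μ` a Haar measure on `G`, `e : V ≃L[ℝ] 𝔤` a
Euclidean frame of the Lie algebra (`V` a real inner product space of dimension `d = dim 𝔤`).  Let `f : G → ℝ` be
continuous with a UNIQUE minimum point `g₀` (`f(g) > f(g₀)` for `g ≠ g₀`) which is NON-DEGENERATE in exponential
coordinates: `f(g₀·Θ(e v)) = f(g₀) + ½⟪Av, v⟫ + o(‖v‖²)` as `v → 0`, `A` symmetric with `⟪Ay, y⟫ > 0` for `y ≠ 0`; let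
`φ : G → ℝ` be continuous.  Then
`β^{d/2} ∫_G e^{−β(f(g) − f(g₀))} φ(g) dμ(g) ⟶ (2π)^{d/2} (det A)^{−1/2} · σ₀(e) · φ(g₀)` as `β → ∞`,
where `σ₀(e) = μ(V_{s_C}) ∕ ν_{s_C}(V_{s_C})` is the density at `X = 0` of `μ` in the exponential coordinates of the
frame (Helgason's (13): `dμ = σ₀ |det((1−e^{−adX})∕adX)| dX`, `det(…)(0) = 1`; the tree's window constant
`IsChartRep.windowConst_eq_div` for `η = e_* dv`).  Breitung's Theorem 41 through Helgason's canonical coordinates;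
the separation hypotheses of `tendsto_laplaceMethod_chart` are discharged by compactness and uniqueness of the
minimiser, integrability by continuity.
[cite: Helgason2000, Ch. I §1 Thm 1.14 (13) p. 96] [cite: Breitung1994, Thm 41 (5.24) p. 56; §2.3 pp. 14–15]
[cite: Hwang1980, main theorem (one-point minimum set)] -/
theorem tendsto_laplaceMethod_haar {f φ : G → ℝ} {g₀ : G} {A : V →ₗ[ℝ] V}
    (hA : A.IsSymmetric) (hpos : ∀ y, y ≠ 0 → 0 < ⟪A y, y⟫_ℝ)
    (hf : Continuous f) (hφ : Continuous φ) (hmin : ∀ g, g ≠ g₀ → f g₀ < f g)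
    (hS2 : (fun v => f (g₀ * h.expChart (e v)) - f g₀ - (1 / 2) * ⟪A v, v⟫_ℝ) =o[𝓝 0] fun v => ‖v‖ ^ 2) :
    Tendsto (fun β : ℝ => β ^ ((finrank ℝ V : ℝ) / 2) * ∫ g, Real.exp (-β * (f g - f g₀)) * φ g ∂μ) atTop
      (𝓝 ((2 * π) ^ ((finrank ℝ V : ℝ) / 2) / Real.sqrt (LinearMap.det A) *
        ((μ (h.window (IsChartRep.chartRadius C)) /
            h.chartMeasure hlie ((volume : Measure V).map e) (IsChartRep.chartRadius C)
              (h.window (IsChartRep.chartRadius C))).toReal * φ g₀))) := by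
  haveI := isAddHaarMeasure_map_frame (V := V) e
  set s := IsChartRep.chartRadius C with hs_def
  have hs0 : 0 < s := IsChartRep.chartRadius_pos
  have hs2 : s / 2 ≤ s := by linarith
  set σ₀ : ℝ := (μ (h.window s) / h.chartMeasure hlie ((volume : Measure V).map e) s (h.window s)).toReal with hσ₀
  set Θ' : V → G := fun v => g₀ * h.expChart (e v) with hΘ'
  set Ω : Set V := e ⁻¹' Metric.ball (0 : C.lie) (s / 2) with hΩ
  set J : V → ℝ := fun v => σ₀ * |LinearMap.det (jac hlie (e v) : C.lie →ₗ[ℝ] C.lie)| with hJ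
  -- chart data
  have hΘ'c : Continuous Θ' := continuous_const.mul (h.continuous_expChart.comp e.continuous)
  have hΘ'0 : Θ' 0 = g₀ := by simp only [hΘ', map_zero, IsChartRep.expChart_zero, mul_one]
  have hΩo : IsOpen Ω := Metric.isOpen_ball.preimage e.continuous
  have hΩ0 : Ω ∈ 𝓝 (0 : V) := hΩo.mem_nhds (by
    rw [hΩ, Set.mem_preimage, map_zero]; exact Metric.mem_ball_self (by linarith))
  have himgΘ : Θ' '' Ω = (fun g => g₀ * g) '' h.window (s / 2) := by
    rw [show Θ' = (fun g => g₀ * g) ∘ h.expChart ∘ e from rfl, Set.image_comp, Set.image_comp,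
      Set.image_preimage_eq _ e.surjective]
    rfl
  have hΘ'Ωm : MeasurableSet (Θ' '' Ω) := by
    rw [himgΘ]; exact (isOpenMap_mul_left g₀ _ (h.isOpen_window hs2)).measurableSet
  -- the chart identity (§1), the density `J`
  have hchart := haar_restrict_translate_window_eq_map_withDensity_frame h hlie μ e g₀
  have hJc : Continuous J :=
    continuous_const.mul (continuous_abs.comp ((continuous_det_jac hlie).comp e.continuous))
  have hJ0 : ∀ v ∈ Ω, 0 ≤ J v := fun v _ => mul_nonneg ENNReal.toReal_nonneg (abs_nonneg _)
  have hJzero : J 0 = σ₀ := by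
    simp only [hJ, map_zero, B13HaarSigmaJacobian.det_jac_zero, abs_one, mul_one]
  -- the analytic hypotheses, in chart form with `x₀ = 0`
  have hS2' : (fun v => f (Θ' v) - f (Θ' 0) - (1 / 2) * ⟪A (v - 0), v - 0⟫_ℝ) =o[𝓝 0] fun v => ‖v - 0‖ ^ 2 := by
    simpa only [sub_zero, hΘ'0] using hS2
  have hsep := sep_in_of_unique_min h e hf hmin (g₀ := g₀)
  have hout := sep_out_of_unique_min h e hf hmin (g₀ := g₀)
  have hint : Integrable (fun g => Real.exp (-(0 : ℝ) * f g) * φ g) μ := by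
    have h1 : IntegrableOn φ Set.univ μ := hφ.continuousOn.integrableOn_compact' isCompact_univ MeasurableSet.univ
    rw [integrableOn_univ] at h1
    refine h1.congr (Eventually.of_forall fun g => ?_)
    simp only [neg_zero, zero_mul, Real.exp_zero, one_mul]
  -- ★ Laplace through the chart
  have key := tendsto_laplaceMethod_chart (μ := μ) hA hpos hΘ'c.measurable hΩo.measurableSet hΘ'Ωm hΩ0 hJc.measurable
    hJ0 hchart hf.measurable hφ.measurable hS2' hsep hout hJc.continuousAt (hφ.comp hΘ'c).continuousAt hint
  simpa only [hΘ'0, hJzero] using key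

include hlie in
/-- **Gibbs measures on a compact group concentrate at a unique non-degenerate minimum — the constant-free form.**
Under the hypotheses of `tendsto_laplaceMethod_haar` (compact group faithfully represented, Haar measure `μ`, `f`
continuous with unique minimiser `g₀`, non-degenerate in exponential coordinates, `φ` continuous):
`∫_G e^{−βf} φ dμ ∕ ∫_G e^{−βf} dμ ⟶ φ(g₀)` as `β → ∞` — the powers of `β`, `det A`, and the Haar density `σ₀` all
cancel. [cite: Hwang1980, main theorem (e^{−nℓ}dμ₀∕Z_n ⇒ δ_{g₀} for a unique non-degenerate minimum)]
[cite: Breitung1994, Thm 41 (5.24) p. 56] [cite: Helgason2000, Ch. I §1 Thm 1.14 (13) p. 96] -/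
theorem tendsto_gibbs_expectation_haar {f φ : G → ℝ} {g₀ : G} {A : V →ₗ[ℝ] V}
    (hA : A.IsSymmetric) (hpos : ∀ y, y ≠ 0 → 0 < ⟪A y, y⟫_ℝ)
    (hf : Continuous f) (hφ : Continuous φ) (hmin : ∀ g, g ≠ g₀ → f g₀ < f g)
    (hS2 : (fun v => f (g₀ * h.expChart (e v)) - f g₀ - (1 / 2) * ⟪A v, v⟫_ℝ) =o[𝓝 0] fun v => ‖v‖ ^ 2) :
    Tendsto (fun β : ℝ => (∫ g, Real.exp (-β * f g) * φ g ∂μ) / ∫ g, Real.exp (-β * f g) ∂μ) atTop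
      (𝓝 (φ g₀)) := by
  haveI := isAddHaarMeasure_map_frame (V := V) e
  set s := IsChartRep.chartRadius C with hs_def
  have hs0 : 0 < s := IsChartRep.chartRadius_pos
  set c : ℝ≥0∞ := μ (h.window s) / h.chartMeasure hlie ((volume : Measure V).map e) s (h.window s) with hc
  have hc' := h.windowConst_ne_zero_and_ne_top hlie ((volume : Measure V).map e) μ hs0 le_rfl
  have hσ₀ : 0 < c.toReal := ENNReal.toReal_pos hc'.1 hc'.2
  set C₀ := (2 * π) ^ ((finrank ℝ V : ℝ) / 2) / Real.sqrt (LinearMap.det A) with hC₀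
  have hC₀ : 0 < C₀ := by
    have hdet : 0 < LinearMap.det A := det_pos_of_inner_pos hA hpos
    positivity
  have hnum := tendsto_laplaceMethod_haar h hlie μ e hA hpos hf hφ hmin hS2
  have hden : Tendsto (fun β : ℝ => β ^ ((finrank ℝ V : ℝ) / 2) *
      ∫ g, Real.exp (-β * (f g - f g₀)) * (fun _ => (1 : ℝ)) g ∂μ) atTop (𝓝 (C₀ * (c.toReal * 1))) :=
    tendsto_laplaceMethod_haar h hlie μ e (φ := fun _ => (1 : ℝ)) hA hpos hf continuous_const hmin hS2
  have hne : C₀ * (c.toReal * 1) ≠ 0 := by positivity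
  have hq := hnum.div hden hne
  have hval : C₀ * (c.toReal * φ g₀) / (C₀ * (c.toReal * 1)) = φ g₀ := by
    field_simp
  rw [hval] at hq
  refine hq.congr' ?_
  filter_upwards [eventually_gt_atTop 0] with β hβ
  have hpow : β ^ ((finrank ℝ V : ℝ) / 2) ≠ 0 := by positivity
  have hexp : Real.exp (β * f g₀) ≠ 0 := (Real.exp_pos _).ne'
  have hshift : ∀ ψ : G → ℝ, ∫ g, Real.exp (-β * (f g - f g₀)) * ψ g ∂μ =
      Real.exp (β * f g₀) * ∫ g, Real.exp (-β * f g) * ψ g ∂μ := by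
    intro ψ
    rw [← integral_const_mul]
    refine integral_congr_ae (Eventually.of_forall fun g => ?_)
    show Real.exp (-β * (f g - f g₀)) * ψ g = Real.exp (β * f g₀) * (Real.exp (-β * f g) * ψ g)
    rw [← mul_assoc, ← Real.exp_add]
    congr 2
    ring
  have h2 : ∫ g, Real.exp (-β * (f g - f g₀)) ∂μ = Real.exp (β * f g₀) * ∫ g, Real.exp (-β * f g) ∂μ := by
    simpa using hshift (fun _ => 1)
  simp only [Pi.div_apply, mul_one]
  rw [hshift φ, h2, ← mul_assoc, ← mul_assoc, mul_div_mul_left _ _ (mul_ne_zero hpow hexp)]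

end Laplace

/-! ## §3 `SU(N)` and `U(N)` themselves, every rank -/

section Classical

open scoped Matrix.Norms.L2Operator
open Literature.MathematicalPhysics.QuantumLattice (unitaryFundamentalRep fundamentalRep)

variable {n : Type*} [Fintype n] [DecidableEq n]
variable {W : Type*} [NormedAddCommGroup W] [InnerProductSpace ℝ W] [FiniteDimensional ℝ W]
  [MeasurableSpace W] [BorelSpace W]

/-- **`SU(N)`, every rank: Gibbs measures `e^{−βf} dU ∕ Z_β` for the Haar measure concentrate at a unique minimum
that is non-degenerate in exponential coordinates** — `∫ e^{−βf} φ dU ∕ ∫ e^{−βf} dU ⟶ φ(U₀)`.  Here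
`Θ = (isChartRep_specialUnitaryGroup).expChart : 𝔰𝔲(N) → SU(N)` is the tree's exponential chart (`↑(Θ X) = exp X`,
`IsChartRep.rho_expChart`), `e : W ≃L[ℝ] 𝔰𝔲(N)` any Euclidean frame, `μ` any Haar measure on `SU(N)` (e.g. the
lattice gauge theory files' `haarProbability`).
[cite: Helgason2000, Ch. I §1 Thm 1.14 (13) p. 96] [cite: Breitung1994, Thm 41 (5.24) p. 56]
[cite: Hwang1980, main theorem (one-point minimum set)] -/
theorem tendsto_gibbs_expectation_haar_specialUnitaryGroup [Nonempty n]
    [MeasurableSpace (specialUnitaryLogChart n).lie] [BorelSpace (specialUnitaryLogChart n).lie]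
    (μ : Measure (Matrix.specialUnitaryGroup n ℂ)) [μ.IsHaarMeasure]
    (e : W ≃L[ℝ] (specialUnitaryLogChart n).lie)
    {f φ : Matrix.specialUnitaryGroup n ℂ → ℝ} {g₀ : Matrix.specialUnitaryGroup n ℂ} {A : W →ₗ[ℝ] W}
    (hA : A.IsSymmetric) (hpos : ∀ y, y ≠ 0 → 0 < ⟪A y, y⟫_ℝ)
    (hf : Continuous f) (hφ : Continuous φ) (hmin : ∀ g, g ≠ g₀ → f g₀ < f g)
    (hS2 : (fun v => f (g₀ * (isChartRep_specialUnitaryGroup (n := n)).expChart (e v)) - f g₀ -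
      (1 / 2) * ⟪A v, v⟫_ℝ) =o[𝓝 0] fun v => ‖v‖ ^ 2) :
    Tendsto (fun β : ℝ => (∫ g, Real.exp (-β * f g) * φ g ∂μ) / ∫ g, Real.exp (-β * f g) ∂μ) atTop
      (𝓝 (φ g₀)) :=
  tendsto_gibbs_expectation_haar (isChartRep_specialUnitaryGroup (n := n))
    (lie_adStable_specialUnitaryGroup (n := n)) μ e hA hpos hf hφ hmin hS2

/-- **`U(N)`, every rank**: the same for the unitary group (`Θ = (isChartRep_unitaryGroup).expChart : 𝔲(N) → U(N)`).
[cite: Helgason2000, Ch. I §1 Thm 1.14 (13) p. 96] [cite: Breitung1994, Thm 41 (5.24) p. 56]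
[cite: Hwang1980, main theorem (one-point minimum set)] -/
theorem tendsto_gibbs_expectation_haar_unitaryGroup
    [MeasurableSpace (unitaryLogChart n).lie] [BorelSpace (unitaryLogChart n).lie]
    (μ : Measure (Matrix.unitaryGroup n ℂ)) [μ.IsHaarMeasure]
    (e : W ≃L[ℝ] (unitaryLogChart n).lie)
    {f φ : Matrix.unitaryGroup n ℂ → ℝ} {g₀ : Matrix.unitaryGroup n ℂ} {A : W →ₗ[ℝ] W}
    (hA : A.IsSymmetric) (hpos : ∀ y, y ≠ 0 → 0 < ⟪A y, y⟫_ℝ)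
    (hf : Continuous f) (hφ : Continuous φ) (hmin : ∀ g, g ≠ g₀ → f g₀ < f g)
    (hS2 : (fun v => f (g₀ * (isChartRep_unitaryGroup (n := n)).expChart (e v)) - f g₀ -
      (1 / 2) * ⟪A v, v⟫_ℝ) =o[𝓝 0] fun v => ‖v‖ ^ 2) :
    Tendsto (fun β : ℝ => (∫ g, Real.exp (-β * f g) * φ g ∂μ) / ∫ g, Real.exp (-β * f g) ∂μ) atTop
      (𝓝 (φ g₀)) :=
  tendsto_gibbs_expectation_haar (isChartRep_unitaryGroup (n := n))
    (lie_adStable_unitaryGroup (n := n)) μ e hA hpos hf hφ hmin hS2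

end Classical


/-! ## §5 The exponential chart of a frame as orbit-constant data
(the group-chart inputs `he1 ∕ he𝓝` of `LaplaceMethodOrbitCompact.lean` and the Haar chart `(U, h)` of
`LaplaceMethodOrbitConstant.lean`, packaged once for every compact group with a log-charted faithful representation) -/

section OrbitData

omit [CompleteSpace 𝔸] [IsTopologicalGroup G] [CompactSpace G] [MeasurableSpace G] [BorelSpace G]
  [FiniteDimensional ℝ C.lie] [MeasurableSpace C.lie] [BorelSpace C.lie] [FiniteDimensional ℝ V] [MeasurableSpace V]
  [BorelSpace V] in
/-- The framed exponential chart sends `0` to `1`. [cite: Helgason2000, Ch. I §1 Thm 1.14 (13) p. 96] -/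
theorem expChart_frame_zero : (fun v => h.expChart (e v)) 0 = 1 := by
  simp only [map_zero, IsChartRep.expChart_zero]

omit [IsTopologicalGroup G] [CompactSpace G] [MeasurableSpace G] [BorelSpace G] [FiniteDimensional ℝ C.lie]
  [MeasurableSpace C.lie] [BorelSpace C.lie] [FiniteDimensional ℝ V] [MeasurableSpace V] [BorelSpace V] in
/-- **The framed exponential chart is open at `0`**: every neighbourhood of `0` in the frame is mapped onto a
neighbourhood of `1` (it contains a canonical window `V_t = Θ(B(0,t))`, which is open and contains `1`).  This is
the hypothesis `he𝓝 : 𝓝 1 ≤ map e (𝓝 0)` of `tendsto_laplaceMethod_orbit_indicator_of_continuous` for the group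
chart `v ↦ Θ(e v)`. [cite: Helgason2000, Ch. I §1 Thm 1.14 (13) p. 96 (the canonical coordinate neighbourhood)] -/
theorem nhds_one_le_map_expChart_frame : 𝓝 (1 : G) ≤ map (fun v => h.expChart (e v)) (𝓝 0) := by
  intro N hN
  rw [Filter.mem_map] at hN
  -- read the preimage in the Lie algebra through the frame
  have h1 : h.expChart ⁻¹' N ∈ 𝓝 (0 : C.lie) := by
    have h2 : (e.symm : C.lie → V) ⁻¹' ((fun v => h.expChart (e v)) ⁻¹' N) ∈ 𝓝 (0 : C.lie) := by
      refine e.symm.continuous.continuousAt.preimage_mem_nhds ?_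
      rw [map_zero]
      exact hN
    refine Filter.mem_of_superset h2 fun X hX => ?_
    simpa only [Set.mem_preimage, ContinuousLinearEquiv.apply_symm_apply] using hX
  obtain ⟨t, ht, hball⟩ := Metric.mem_nhds_iff.1 h1
  have ht' : 0 < min t (IsChartRep.chartRadius C) := lt_min ht IsChartRep.chartRadius_pos
  have hwin : h.window (min t (IsChartRep.chartRadius C)) ⊆ N := by
    rintro g ⟨X, hX, rfl⟩
    exact hball (Metric.ball_subset_ball (min_le_left _ _) hX)
  exact Filter.mem_of_superset ((h.isOpen_window (min_le_right _ _)).mem_nhds (h.one_mem_window ht')) hwin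

/-- ★ **The Haar chart of the framed exponential chart, packaged**: an open `U ∋ 0` in the frame `V` on which
`v ↦ Θ(e v)` is injective, with a CONTINUOUS density `hd ≥ 0` such that `μ|_{Θ(e(U))} = (Θ∘e)_*((hd · dv)|_U)`,
and `hd(0) = σ₀(e) = μ(V_{s_C}) ∕ ν_{s_C}(V_{s_C}) > 0` (the window constant; `det jac(0) = 1`).  This is exactly the
Haar-chart input `(U, h)` of `windowConst_ratio_eq_of_continuous` ∕ `tendsto_laplaceMethod_orbit_indicator_closedForm`
(file `LaplaceMethodOrbitConstant.lean`) for the acting group, so that the orbit constant there reads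
`J(0,0) ∕ (|S| · σ₀(e))`. [cite: Helgason2000, Ch. I §1 Thm 1.14 (13) p. 96] [cite: Balaban1985UV3, p. 260] -/
theorem exists_haarChart_expChart_frame :
    ∃ (U : Set V) (hd : V → ℝ), IsOpen U ∧ (0 : V) ∈ U ∧ Set.InjOn (fun v => h.expChart (e v)) U ∧
      Continuous hd ∧ (∀ v, 0 ≤ hd v) ∧ 0 < hd 0 ∧
      hd 0 = (μ (h.window (IsChartRep.chartRadius C)) /
          h.chartMeasure hlie ((volume : Measure V).map e) (IsChartRep.chartRadius C)
            (h.window (IsChartRep.chartRadius C))).toReal ∧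
      μ.restrict ((fun v => h.expChart (e v)) '' U) =
        (((volume : Measure V).restrict U).withDensity fun v => ENNReal.ofReal (hd v)).map
          (fun v => h.expChart (e v)) := by
  haveI := isAddHaarMeasure_map_frame (V := V) e
  set s := IsChartRep.chartRadius C with hs_def
  have hs0 : 0 < s := IsChartRep.chartRadius_pos
  have hs2 : s / 2 ≤ s := by linarith
  set σ₀ : ℝ := (μ (h.window s) / h.chartMeasure hlie ((volume : Measure V).map e) s (h.window s)).toReal with hσ₀
  refine ⟨e ⁻¹' Metric.ball (0 : C.lie) (s / 2),
    fun v => σ₀ * |LinearMap.det (jac hlie (e v) : C.lie →ₗ[ℝ] C.lie)|,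
    Metric.isOpen_ball.preimage e.continuous, ?_, ?_, ?_, ?_, ?_, ?_, ?_⟩
  · rw [Set.mem_preimage, map_zero]
    exact Metric.mem_ball_self (by linarith)
  · exact (h.injOn_expChart hs2).comp e.injective.injOn fun v hv => hv
  · exact continuous_const.mul (continuous_abs.comp ((continuous_det_jac hlie).comp e.continuous))
  · exact fun v => mul_nonneg ENNReal.toReal_nonneg (abs_nonneg _)
  · have hc := h.windowConst_ne_zero_and_ne_top hlie ((volume : Measure V).map e) μ hs0 le_rfl
    have hpos : 0 < σ₀ := ENNReal.toReal_pos hc.1 hc.2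
    simpa only [map_zero, B13HaarSigmaJacobian.det_jac_zero, abs_one, mul_one] using hpos
  · simp only [map_zero, B13HaarSigmaJacobian.det_jac_zero, abs_one, mul_one, hσ₀]
  · exact haar_restrict_window_eq_map_withDensity_frame h hlie μ e

end OrbitData

end Literature.Analysis.Asymptotics
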